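import Literature.MathematicalPhysics.QuantumFieldTheory.Balaban1983to89.B9Eq373DerivativeRemainderL2

/-!
# `Balaban1983to89.B9Eq3100LeibnizCommutatorDiv` — T. Bałaban, *Propagators for lattice gauge theories in a background field*, Commun. Math.
# Phys. **99** (1985) 389–434 [Balaban1985BackgroundPropagators] (3.100) p. 413 «similarly for adjoint derivatives» with p. 414 l. 1–3, (3.8) p. 392:
# **THE LEIBNIZ (PLAIN COMMUTATOR) LETTERS OF THE COVARIANT DIVERGENCE `D*_U` WITH A SLOWLY VARYING FUNCTION** — `[h, D*_U]` IS `c·Σ_μ` of the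
# multiplications by the increments of `h` over the incoming bonds, `[h,[h, D*_U]]` the same with SQUARED increments; on the chain's weighted `L²`
# carriers `BondL2K → SiteL2K`: `‖h·D*A − D*(h̃A)‖ ≤ √d·‖c‖θM_T·‖A‖`, `Σ_j ‖[h_j, D*]A‖² ≤ d(‖c‖M_T)²Θ₂·‖A‖²` (`a₂`), `‖Σ_j [h_j,[h_j, D*]]A‖ ≤
# √d·‖c‖M_TΘ₂·‖A‖` (`k₂`), `‖D*A‖ ≤ 2√d·‖c‖(1+M_T)·‖A‖` (`t₂`), for ANY scalar `c` — route R2′ STEP B8′ (S-P7 «IMS assembly»), instance-ledger rows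
# L4 ∕ L6 ∕ L7 of `t4/ROUTES-NE9.md` v13.30 for kernel 7's local letter `T₂ = D*_U`; the `η`-readings are the sibling `B9Eq3100LeibnizCommutatorEtaFree`'s

statement-level skeleton of published theorems with citation tags; proofs where landed; nothing here is a claim about the Yang–Mills mass gap

CITATION HEADER (lean-in-tree rule).  Audit cell `pub-balaban`, sub-cell `t4`, BINDER row NE9; filed by NE9 formalisation-swarm LEAF PROVER 04
(`b2b-balaban-t4-ne9-formalise-leaf-04`, gen 76) as the companion of `B9Eq3100LeibnizCommutatorCurl` (same seat, same dress: ANY maps of the carriers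
acting pointwise as the multiplications — NE9 leaf-05's `B9Eq3101ConjugationLettersChain` convention —, the letters in the shape NE9 leaf-01's
`B9Eq387QuadraticPartitionIMS` and kernel 7 `B9Eq387IMSAssembly` consume).  Source READ by this seat in the held text
`paper:balaban1985-cmp99-background-propagators` (journal page = PDF page + 388): p. 392 (3.8), pp. 413–414 (3.100) and l. 1–3.

THE PRINT (verbatim).  p. 413, (3.100): *«(D_μ h A_ν)(x) = h(x)(D_μ A_ν)(x) + (∂_μ h)(x)R(U(x, x + ηe_μ))A_ν(x + ηe_μ), similarly for adjoint derivatives,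
hence the commutators [D*D, h] and [DD*, h]»* (p. 414) *«are first order differential operators with coefficients determined by derivatives of the
function h. They are of the order O(M⁻¹), or O(M⁻²), if considered on a proper scale.»*; p. 392, (3.8): `(D*A)(x) = Σ_μ η⁻¹(R(U(x, x − ηe_μ))A(x − ηe_μ, x)
− A(x, x + ηe_μ))` — the tree's `B9Eq33CovDerivVector.covDiv c S`: `(D*A)(y) = c·Σ_μ (S(y − e_μ, μ)A(y − e_μ, μ) − A(y, μ))`.

WHY (INSTANCE LEDGER v13.30 rows L4 ∕ L6 ∕ L7, `t4/ROUTES-NE9.md`).  Kernel 7's assembly needs for the local letter `T₂ = D*_U` (bonds → sites) the same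
three sizes as for the curl: `ad_j D*` (L6, ✗ «plain commutator identities for curl ∕ div NOT TYPED»), `K₂ = Σ_j ad_j(ad_j D*)` with `k₂` and the
product `t₂k₂` (L7, ✗), `a₂` (L6).  Written DIRECTLY from (3.8) (any `S`, any `c`; no adjointness, no `conj c = c` needed), so the letters hold for
the chain's `covDivL2K ℂ c₀ η⁻¹ (adTransportW φ U⁻¹)` at every unit-bounded background.

WHAT IS PROVED (sorry-free; proof lane — no `def`, no `Prop` placeholder; [folklore] Leibniz rule + finite sums; nothing of [B9] asserted).
* §1 IDENTITIES (any commutative scalar ring; `σ` sampled on bonds at `b₋`): **`comm_covDiv_apply`** (`σ(y)·(D*A)(y) − (D*(σ̃A))(y) =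
  c·Σ_μ (σ(y) − σ(y − e_μ))·S(y−e_μ, μ)A(y−e_μ, μ)` — the outgoing bonds cancel exactly), **`comm_comm_covDiv_apply`** (squared increments),
  **`sum_comm_comm_covDiv_apply`** (a finite family: coefficients `Σ_j(σ_j(y) − σ_j(y−e_μ))²`).
* §2 TOOLS on the carriers: `sum_site_dir_unshift` (`Σ_y Σ_μ g(y−e_μ, μ) = Σ_b g(b)`), `norm_site_le_of_instar_bound` (a pointwise bound by the
  in-star `K·Σ_μ‖A(y−e_μ, μ)‖` gives `‖G‖ ≤ √d·K·‖A‖`), `norm_site_le_of_star_bound` (in- and out-star: `2√d·K`).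
* §3 THE LETTERS ON `BondL2K → SiteL2K` (`B11Eq103H1Complex.covDivL2K 𝕜 c₀ c S`; ANY maps `χS` (bonds, `χ(b₋)`) and `χ0` (sites, `χ(y)`) acting as the
  multiplications; transporters `‖S(b)v‖ ≤ M_T‖v‖`): **`norm_comm_covDivL2K_le`** (`‖χ0(D*A) − D*(χS A)‖ ≤ √d·‖c‖θM_T·‖A‖` under `|χ(b₋) − χ(b₊)| ≤ θ`),
  **`sum_norm_sq_comm_covDivL2K_le`** (`a₂`: `Σ_j ‖·‖² ≤ d(‖c‖M_T)²Θ₂·‖A‖²` under `Σ_j(χ_j(b₋) − χ_j(b₊))² ≤ Θ₂`), **`norm_sum_comm_comm_covDivL2K_le`**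
  (`k₂`: `≤ √d·‖c‖M_TΘ₂·‖A‖`), **`norm_covDivL2K_le_of_transport`** (`t₂`: `‖D*A‖ ≤ 2√d·‖c‖(1+M_T)·‖A‖`; the tree's `norm_covDivL2K_le` is the adjoint-road
  `εR` twin).  §4 non-vacuity (constant cutoff).
HONEST SCOPE.  Exact Leibniz algebra and crude counting on the chain's OWN divergence; cutoffs and their displayed facts are HYPOTHESES (no partition
constructed — FREEZE e34b3e0c (0)); constants crude; no estimate of [B9]; rows of ONE sub-step of a route step, NOT NE9 (cell pub-balaban: NE9 NOT
PRINTED ∕ NOT PROVED; «NE9 ⇐ the named binders»; row WALLED ON A MODEL (O-NE9-1); spine PROVED 0∕9; rung (B)+1 on a finite T⁴ — NOT infinite volume,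
NOT mass gap, NOT Clay; HONEST DEPENDENCY: continuum YM on T⁴ ⇐ BetaPertH ∧ nine spine estimates (0/9 proved); BetaPertH ⇐ (D1) ∧ (D4) ∧ CAP+tail;
G-an2-4 gates asym, D1 and NE2/3/4).  NEW file importing `B9Eq373DerivativeRemainderL2` only; nothing modified.  Net new unproved facts: 0.
-/

noncomputable section

open scoped InnerProductSpace ComplexConjugate BigOperators
open Finset

namespace Literature.MathematicalPhysics.QuantumFieldTheory.Balaban1983to89.B9Eq3100LeibnizCommutatorDiv

open B9SectCLatticeCarrier (Bond shift unshift bpos btgt shift_unshift)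
open B4Sect5Torus (TSite)
open B9Eq311L2Pairing (WL2)
open B11Eq103H1Complex (SiteL2K BondL2K covDivL2K equiv_covDivL2K)
open B9Eq33CovDerivVector (covDiv covDiv_apply shiftEquiv)
open B9Eq373DerivativeRemainderL2 (norm_le_of_sum_sq_le)

/-! ## §1 (3.100) for the divergence: the commutator with a multiplication is `c·Σ_μ` of multiplications by the incoming increments -/

section Identity

variable {𝕜 : Type*} [CommRing 𝕜] {d : ℕ} {Pd : Fin d → ℕ} {W : Type*} [AddCommGroup W] [Module 𝕜 W]

/-- **(3.100) FOR THE DIVERGENCE — THE SINGLE COMMUTATOR IS A SUM OF MULTIPLICATION LETTERS.**  For ANY scalar site function `σ` (acting on bond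
functions by `σ(b₋)`), any scalar `c`, any linear transporter data `S`:
`σ(y)·(D*A)(y) − (D*(σ̃A))(y) = c·Σ_μ (σ(y) − σ(y−e_μ))·S(y−e_μ, μ)A(y−e_μ, μ)` — the outgoing bonds `A(y, μ)` cancel exactly. [folklore] (Leibniz rule)
[cite: Balaban1985BackgroundPropagators, (3.100) p.413 «similarly for adjoint derivatives», (3.8) p.392] -/
theorem comm_covDiv_apply (σ : TSite d Pd → 𝕜) (c : 𝕜) (S : Bond d Pd → W →ₗ[𝕜] W) (A : Bond d Pd → W) (y : TSite d Pd) :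
    σ y • covDiv c S A y - covDiv c S (fun b => σ (bpos b) • A b) y =
      c • ∑ μ, (σ y - σ (unshift μ y)) • S (unshift μ y, μ) (A (unshift μ y, μ)) := by
  simp only [covDiv_apply, bpos, map_smul, smul_sub, Finset.smul_sum, ← Finset.sum_sub_distrib]
  exact Finset.sum_congr rfl fun μ _ => by module

/-- **THE DOUBLE COMMUTATOR — SQUARED INCREMENTS**: `σ(y)·([σ,D*]A)(y) − ([σ,D*](σ̃A))(y) = c·Σ_μ (σ(y) − σ(y−e_μ))²·S(y−e_μ, μ)A(y−e_μ, μ)`.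
[folklore] (Leibniz rule, iterated) [cite: Balaban1985BackgroundPropagators, (3.100) p.413, p.414 «O(M⁻²)»] -/
theorem comm_comm_covDiv_apply (σ : TSite d Pd → 𝕜) (c : 𝕜) (S : Bond d Pd → W →ₗ[𝕜] W) (A : Bond d Pd → W) (y : TSite d Pd) :
    σ y • (σ y • covDiv c S A y - covDiv c S (fun b => σ (bpos b) • A b) y) -
        (σ y • covDiv c S (fun b => σ (bpos b) • A b) y - covDiv c S (fun b => σ (bpos b) • (σ (bpos b) • A b)) y) =
      c • ∑ μ, (σ y - σ (unshift μ y)) ^ 2 • S (unshift μ y, μ) (A (unshift μ y, μ)) := by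
  simp only [covDiv_apply, bpos, map_smul, smul_sub, Finset.smul_sum, ← Finset.sum_sub_distrib]
  exact Finset.sum_congr rfl fun μ _ => by module

/-- **A FINITE FAMILY OF CUTOFFS**: `Σ_j (σ_j(y)·([σ_j,D*]A)(y) − ([σ_j,D*](σ̃_jA))(y)) = c·Σ_μ (Σ_j(σ_j(y) − σ_j(y−e_μ))²)·S(y−e_μ, μ)A(y−e_μ, μ)` —
`K₂ = Σ_j ad_j(ad_j D*)` is a sum of multiplication letters. [folklore] [cite: Balaban1985BackgroundPropagators, (3.100) p.413, p.408 «Σ h²_□ = 1»] -/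
theorem sum_comm_comm_covDiv_apply {J : Type*} (s : Finset J) (σ : J → TSite d Pd → 𝕜) (c : 𝕜) (S : Bond d Pd → W →ₗ[𝕜] W)
    (A : Bond d Pd → W) (y : TSite d Pd) :
    ∑ j ∈ s, (σ j y • (σ j y • covDiv c S A y - covDiv c S (fun b => σ j (bpos b) • A b) y) -
        (σ j y • covDiv c S (fun b => σ j (bpos b) • A b) y - covDiv c S (fun b => σ j (bpos b) • (σ j (bpos b) • A b)) y)) =
      c • ∑ μ, (∑ j ∈ s, (σ j y - σ j (unshift μ y)) ^ 2) • S (unshift μ y, μ) (A (unshift μ y, μ)) := by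
  simp only [comm_comm_covDiv_apply, ← Finset.smul_sum, Finset.sum_smul]
  rw [Finset.sum_comm]

end Identity

/-! ## §2 Tools: the in-star of a site covers every bond once; pointwise star bounds give `L²` bounds -/

section Tools

variable {𝕜 : Type*} [RCLike 𝕜] {d : ℕ} {Pd : Fin d → ℕ} {W : Type*} [NormedAddCommGroup W] [InnerProductSpace 𝕜 W]
  {c₀ : ℝ} [Fact (0 < c₀)]

omit [Fact (0 < c₀)] in
/-- `Σ_y Σ_μ g(y − e_μ, μ) = Σ_b g(b)` — each bond is the incoming bond of direction `μ` of exactly one site. [folklore]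
[cite: Balaban1985BackgroundPropagators, (3.8) p.392] -/
theorem sum_site_dir_unshift (g : Bond d Pd → ℝ) : ∑ y : TSite d Pd, ∑ μ : Fin d, g (unshift μ y, μ) = ∑ b : Bond d Pd, g b := by
  rw [Fintype.sum_prod_type, Finset.sum_comm]
  conv_rhs => rw [Finset.sum_comm]
  exact Finset.sum_congr rfl fun μ _ => Equiv.sum_comp (shiftEquiv μ).symm (fun x => g (x, μ))

/-- **A POINTWISE IN-STAR BOUND GIVES AN `L²` BOUND**: if `‖G(y)‖ ≤ K·Σ_μ ‖A(y−e_μ, μ)‖` at every site (`0 ≤ K`), then `‖G‖ ≤ √d·K·‖A‖` on the weighted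
carriers (Cauchy–Schwarz over the `d` directions; `sum_site_dir_unshift`). [folklore] [cite: Balaban1985BackgroundPropagators, (3.8) p.392, (3.11) p.392] -/
theorem norm_site_le_of_instar_bound (A : BondL2K 𝕜 d Pd c₀ W) (G : SiteL2K 𝕜 d Pd c₀ W) {K : ℝ} (hK : 0 ≤ K)
    (h : ∀ y : TSite d Pd, ‖WL2.equiv 𝕜 _ W G y‖ ≤ K * ∑ μ : Fin d, ‖WL2.equiv 𝕜 _ W A (unshift μ y, μ)‖) :
    ‖G‖ ≤ Real.sqrt d * K * ‖A‖ := by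
  have hc₀ : 0 < c₀ := Fact.out
  refine norm_le_of_sum_sq_le A G (by positivity) ?_
  set a : Bond d Pd → W := WL2.equiv 𝕜 _ W A with ha
  have hpt : ∀ y : TSite d Pd, c₀ * ‖WL2.equiv 𝕜 _ W G y‖ ^ 2 ≤ K ^ 2 * d * ∑ μ : Fin d, c₀ * ‖a (unshift μ y, μ)‖ ^ 2 := fun y => by
    have h1 : ‖WL2.equiv 𝕜 _ W G y‖ ^ 2 ≤ (K * ∑ μ : Fin d, ‖a (unshift μ y, μ)‖) ^ 2 := by
      have := h y; gcongr
    have h2 : (∑ μ : Fin d, ‖a (unshift μ y, μ)‖) ^ 2 ≤ d * ∑ μ : Fin d, ‖a (unshift μ y, μ)‖ ^ 2 := by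
      have h := sq_sum_le_card_mul_sum_sq (s := (univ : Finset (Fin d))) (f := fun μ => ‖a (unshift μ y, μ)‖)
      simpa using h
    rw [mul_sum]
    calc c₀ * ‖WL2.equiv 𝕜 _ W G y‖ ^ 2 ≤ c₀ * (K ^ 2 * (d * ∑ μ : Fin d, ‖a (unshift μ y, μ)‖ ^ 2)) := by
          refine mul_le_mul_of_nonneg_left (h1.trans ?_) hc₀.le
          rw [mul_pow]; exact mul_le_mul_of_nonneg_left h2 (sq_nonneg _)
      _ = ∑ μ : Fin d, K ^ 2 * d * (c₀ * ‖a (unshift μ y, μ)‖ ^ 2) := by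
          rw [mul_sum, mul_sum, mul_sum]; exact sum_congr rfl fun μ _ => by ring
  calc ∑ y : TSite d Pd, c₀ * ‖WL2.equiv 𝕜 _ W G y‖ ^ 2 ≤ ∑ y : TSite d Pd, K ^ 2 * d * ∑ μ : Fin d, c₀ * ‖a (unshift μ y, μ)‖ ^ 2 :=
        sum_le_sum fun y _ => hpt y
    _ = K ^ 2 * d * ∑ b : Bond d Pd, c₀ * ‖a b‖ ^ 2 := by
        rw [← mul_sum, sum_site_dir_unshift (fun b => c₀ * ‖a b‖ ^ 2)]
    _ = (Real.sqrt d * K) ^ 2 * ∑ b : Bond d Pd, c₀ * ‖a b‖ ^ 2 := by rw [mul_pow, Real.sq_sqrt (Nat.cast_nonneg d)]; ring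

/-- **IN- AND OUT-STAR**: if `‖G(y)‖ ≤ K·Σ_μ (‖A(y−e_μ, μ)‖ + ‖A(y, μ)‖)` at every site (`0 ≤ K`), then `‖G‖ ≤ 2√d·K·‖A‖`. [folklore]
[cite: Balaban1985BackgroundPropagators, (3.8) p.392, (3.11) p.392] -/
theorem norm_site_le_of_star_bound (A : BondL2K 𝕜 d Pd c₀ W) (G : SiteL2K 𝕜 d Pd c₀ W) {K : ℝ} (hK : 0 ≤ K)
    (h : ∀ y : TSite d Pd, ‖WL2.equiv 𝕜 _ W G y‖ ≤ K * ∑ μ : Fin d, (‖WL2.equiv 𝕜 _ W A (unshift μ y, μ)‖ + ‖WL2.equiv 𝕜 _ W A (y, μ)‖)) :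
    ‖G‖ ≤ 2 * Real.sqrt d * K * ‖A‖ := by
  have hc₀ : 0 < c₀ := Fact.out
  refine norm_le_of_sum_sq_le A G (by positivity) ?_
  set a : Bond d Pd → W := WL2.equiv 𝕜 _ W A with ha
  have hpt : ∀ y : TSite d Pd, c₀ * ‖WL2.equiv 𝕜 _ W G y‖ ^ 2 ≤
      2 * K ^ 2 * d * (∑ μ : Fin d, c₀ * ‖a (unshift μ y, μ)‖ ^ 2 + ∑ μ : Fin d, c₀ * ‖a (y, μ)‖ ^ 2) := fun y => by
    have h1 : ‖WL2.equiv 𝕜 _ W G y‖ ^ 2 ≤ (K * ∑ μ : Fin d, (‖a (unshift μ y, μ)‖ + ‖a (y, μ)‖)) ^ 2 := by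
      have := h y; gcongr
    have h2 : (∑ μ : Fin d, (‖a (unshift μ y, μ)‖ + ‖a (y, μ)‖)) ^ 2 ≤ d * ∑ μ : Fin d, (‖a (unshift μ y, μ)‖ + ‖a (y, μ)‖) ^ 2 := by
      have h := sq_sum_le_card_mul_sum_sq (s := (univ : Finset (Fin d))) (f := fun μ => ‖a (unshift μ y, μ)‖ + ‖a (y, μ)‖)
      simpa using h
    have h3 : ∑ μ : Fin d, (‖a (unshift μ y, μ)‖ + ‖a (y, μ)‖) ^ 2 ≤ 2 * (∑ μ : Fin d, ‖a (unshift μ y, μ)‖ ^ 2 + ∑ μ : Fin d, ‖a (y, μ)‖ ^ 2) := by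
      rw [← sum_add_distrib, mul_sum]
      exact sum_le_sum fun μ _ => by nlinarith [sq_nonneg (‖a (unshift μ y, μ)‖ - ‖a (y, μ)‖)]
    have hd : (0 : ℝ) ≤ d := Nat.cast_nonneg d
    calc c₀ * ‖WL2.equiv 𝕜 _ W G y‖ ^ 2 ≤ c₀ * (K ^ 2 * (d * (2 * (∑ μ : Fin d, ‖a (unshift μ y, μ)‖ ^ 2 + ∑ μ : Fin d, ‖a (y, μ)‖ ^ 2)))) := by
          refine mul_le_mul_of_nonneg_left (h1.trans ?_) hc₀.le
          rw [mul_pow]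
          exact mul_le_mul_of_nonneg_left (h2.trans (mul_le_mul_of_nonneg_left h3 hd)) (sq_nonneg _)
      _ = 2 * K ^ 2 * d * (∑ μ : Fin d, c₀ * ‖a (unshift μ y, μ)‖ ^ 2 + ∑ μ : Fin d, c₀ * ‖a (y, μ)‖ ^ 2) := by
          rw [← mul_sum, ← mul_sum]; ring
  calc ∑ y : TSite d Pd, c₀ * ‖WL2.equiv 𝕜 _ W G y‖ ^ 2
      ≤ ∑ y : TSite d Pd, 2 * K ^ 2 * d * (∑ μ : Fin d, c₀ * ‖a (unshift μ y, μ)‖ ^ 2 + ∑ μ : Fin d, c₀ * ‖a (y, μ)‖ ^ 2) :=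
        sum_le_sum fun y _ => hpt y
    _ = 2 * K ^ 2 * d * (∑ b : Bond d Pd, c₀ * ‖a b‖ ^ 2 + ∑ b : Bond d Pd, c₀ * ‖a b‖ ^ 2) := by
        rw [← mul_sum, sum_add_distrib, sum_site_dir_unshift (fun b => c₀ * ‖a b‖ ^ 2), ← Fintype.sum_prod_type (f := fun b : Bond d Pd => c₀ * ‖a b‖ ^ 2)]
    _ = (2 * Real.sqrt d * K) ^ 2 * ∑ b : Bond d Pd, c₀ * ‖a b‖ ^ 2 := by rw [mul_pow, mul_pow, Real.sq_sqrt (Nat.cast_nonneg d)]; ring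

end Tools

/-! ## §3 The letters on the weighted `L²` carriers `BondL2K → SiteL2K`, for any maps acting as the multiplications -/

section L2

variable {𝕜 : Type*} [RCLike 𝕜] {d : ℕ} {Pd : Fin d → ℕ} {W : Type*} [NormedAddCommGroup W] [InnerProductSpace 𝕜 W]
  {c₀ : ℝ} [Fact (0 < c₀)] {S : Bond d Pd → W →ₗ[𝕜] W} {MT : ℝ}

omit [Fact (0 < c₀)] in
/-- the pointwise size of a sum of multiplication letters over the in-star: `‖c·Σ_μ u_μ·S(y−e_μ,μ)A(y−e_μ,μ)‖ ≤ ‖c‖U M_T·Σ_μ ‖A(y−e_μ,μ)‖` when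
`|u_μ| ≤ U`. [folklore] [cite: Balaban1985BackgroundPropagators, (3.100) p.413] -/
private theorem norm_smul_sum_le (hR : ∀ b v, ‖S b v‖ ≤ MT * ‖v‖) (c : 𝕜) {u : Fin d → ℝ} {U : ℝ} (hu : ∀ μ, |u μ| ≤ U)
    (a : Bond d Pd → W) (y : TSite d Pd) :
    ‖c • ∑ μ : Fin d, (u μ : 𝕜) • S (unshift μ y, μ) (a (unshift μ y, μ))‖ ≤ ‖c‖ * U * MT * ∑ μ : Fin d, ‖a (unshift μ y, μ)‖ := by
  rw [norm_smul, mul_assoc, mul_assoc, mul_sum, mul_sum]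
  refine mul_le_mul_of_nonneg_left ((norm_sum_le _ _).trans (sum_le_sum fun μ _ => ?_)) (norm_nonneg c)
  rw [norm_smul, RCLike.norm_ofReal]
  exact mul_le_mul (hu μ) (hR _ _) (norm_nonneg _) ((abs_nonneg _).trans (hu μ))

omit [RCLike 𝕜] [InnerProductSpace 𝕜 W] [Fact (0 < c₀)] in
/-- a finite sum of carrier elements evaluates pointwise. [folklore] [cite: Balaban1985BackgroundPropagators, (3.11) p.392] -/
private theorem equiv_sum {X : Type*} {w : X → ℝ} {J : Type*} (s : Finset J) (f : J → WL2 𝕜 w W) (x : X) :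
    WL2.equiv 𝕜 w W (∑ j ∈ s, f j) x = ∑ j ∈ s, WL2.equiv 𝕜 w W (f j) x := by
  induction s using Finset.cons_induction with
  | empty => simp
  | cons a s h ih => rw [Finset.sum_cons, Finset.sum_cons, WL2.equiv_add, Pi.add_apply, ih]

variable (χS : BondL2K 𝕜 d Pd c₀ W → BondL2K 𝕜 d Pd c₀ W) (χ0 : SiteL2K 𝕜 d Pd c₀ W → SiteL2K 𝕜 d Pd c₀ W) {χ : TSite d Pd → ℝ}

/-- **THE SINGLE-COMMUTATOR LETTER ON `L²`** (row L6 for `T₂ = D*`): maps `χS` (bonds, `χ(b₋)`), `χ0` (sites, `χ(y)`) acting as the multiplications,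
bond increments `|χ(b₋) − χ(b₊)| ≤ θ` (`0 ≤ θ`), transporters `‖S(b)v‖ ≤ M_T‖v‖` (`0 ≤ M_T`): `‖χ0(D*A) − D*(χS A)‖ ≤ √d·‖c‖θM_T·‖A‖`. [folklore]
[cite: Balaban1985BackgroundPropagators, (3.100) p.413, p.414 «O(M⁻¹)», (3.8) p.392] -/
theorem norm_comm_covDivL2K_le (hMT : 0 ≤ MT) (hR : ∀ b v, ‖S b v‖ ≤ MT * ‖v‖) {θ : ℝ} (hθ : 0 ≤ θ)
    (hχ : ∀ b : Bond d Pd, |χ (bpos b) - χ (btgt b)| ≤ θ)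
    (hS : ∀ (A : BondL2K 𝕜 d Pd c₀ W) (b : Bond d Pd), WL2.equiv 𝕜 _ W (χS A) b = (χ (bpos b) : 𝕜) • WL2.equiv 𝕜 _ W A b)
    (h0 : ∀ (f : SiteL2K 𝕜 d Pd c₀ W) (y : TSite d Pd), WL2.equiv 𝕜 _ W (χ0 f) y = (χ y : 𝕜) • WL2.equiv 𝕜 _ W f y) (c : 𝕜)
    (A : BondL2K 𝕜 d Pd c₀ W) :
    ‖χ0 (covDivL2K 𝕜 c₀ c S A) - covDivL2K 𝕜 c₀ c S (χS A)‖ ≤ Real.sqrt d * (‖c‖ * θ * MT) * ‖A‖ := by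
  refine norm_site_le_of_instar_bound A _ (by positivity) fun y => ?_
  have hSA : WL2.equiv 𝕜 _ W (χS A) = fun b => (χ (bpos b) : 𝕜) • WL2.equiv 𝕜 _ W A b := funext (hS A)
  rw [WL2.equiv_sub, Pi.sub_apply, h0, equiv_covDivL2K, equiv_covDivL2K, hSA, comm_covDiv_apply (fun x => (χ x : 𝕜)) c S _ y]
  simp only [← RCLike.ofReal_sub]
  refine norm_smul_sum_le hR c (fun μ => ?_) _ y
  have h := hχ (unshift μ y, μ)
  simp only [bpos, btgt, shift_unshift] at h
  rwa [abs_sub_comm] at h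

/-- **THE FIRST-ORDER SQUARE `a₂` OF A FAMILY ON `L²`**: maps `χS_j`, `χ0_j` acting as the multiplications by `χ_j`, overlap bound
`Σ_j(χ_j(b₋) − χ_j(b₊))² ≤ Θ₂`, transporters `‖S(b)v‖ ≤ M_T‖v‖`: `Σ_j ‖χ0_j(D*A) − D*(χS_j A)‖² ≤ d(‖c‖M_T)²Θ₂·‖A‖²`. [folklore]
[cite: Balaban1985BackgroundPropagators, (3.100) p.413, p.408 «Σ h²_□ = 1», (3.8) p.392] -/
theorem sum_norm_sq_comm_covDivL2K_le (hR : ∀ b v, ‖S b v‖ ≤ MT * ‖v‖) {J : Type*} (s : Finset J) {χf : J → TSite d Pd → ℝ} {Θ₂ : ℝ}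
    (hχ : ∀ b : Bond d Pd, ∑ j ∈ s, (χf j (bpos b) - χf j (btgt b)) ^ 2 ≤ Θ₂)
    (χSf : J → BondL2K 𝕜 d Pd c₀ W → BondL2K 𝕜 d Pd c₀ W) (χ0f : J → SiteL2K 𝕜 d Pd c₀ W → SiteL2K 𝕜 d Pd c₀ W)
    (hS : ∀ j (A : BondL2K 𝕜 d Pd c₀ W) (b : Bond d Pd), WL2.equiv 𝕜 _ W (χSf j A) b = (χf j (bpos b) : 𝕜) • WL2.equiv 𝕜 _ W A b)
    (h0 : ∀ j (f : SiteL2K 𝕜 d Pd c₀ W) (y : TSite d Pd), WL2.equiv 𝕜 _ W (χ0f j f) y = (χf j y : 𝕜) • WL2.equiv 𝕜 _ W f y) (c : 𝕜)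
    (A : BondL2K 𝕜 d Pd c₀ W) :
    ∑ j ∈ s, ‖χ0f j (covDivL2K 𝕜 c₀ c S A) - covDivL2K 𝕜 c₀ c S (χSf j A)‖ ^ 2 ≤ d * (‖c‖ * MT) ^ 2 * Θ₂ * ‖A‖ ^ 2 := by
  have hc₀ : 0 < c₀ := Fact.out
  set a : Bond d Pd → W := WL2.equiv 𝕜 _ W A with ha
  -- read each element through the identity
  have hread : ∀ j ∈ s, ∀ y : TSite d Pd, WL2.equiv 𝕜 _ W (χ0f j (covDivL2K 𝕜 c₀ c S A) - covDivL2K 𝕜 c₀ c S (χSf j A)) y =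
      c • ∑ μ, ((χf j y - χf j (unshift μ y) : ℝ) : 𝕜) • S (unshift μ y, μ) (a (unshift μ y, μ)) := fun j _ y => by
    have hSA : WL2.equiv 𝕜 _ W (χSf j A) = fun b => (χf j (bpos b) : 𝕜) • a b := funext (hS j A)
    rw [WL2.equiv_sub, Pi.sub_apply, h0, equiv_covDivL2K, equiv_covDivL2K, hSA, comm_covDiv_apply (fun x => (χf j x : 𝕜)) c S _ y]
    simp only [← RCLike.ofReal_sub]
    rfl
  -- pointwise: ‖G_j y‖² ≤ (‖c‖M_T)²·d·Σ_μ δ_{jμ}² ‖a_μ‖²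
  have hpt : ∀ j ∈ s, ∀ y : TSite d Pd, ‖WL2.equiv 𝕜 _ W (χ0f j (covDivL2K 𝕜 c₀ c S A) - covDivL2K 𝕜 c₀ c S (χSf j A)) y‖ ^ 2 ≤
      (‖c‖ * MT) ^ 2 * (d * ∑ μ : Fin d, (χf j y - χf j (unshift μ y)) ^ 2 * ‖a (unshift μ y, μ)‖ ^ 2) := fun j hj y => by
    rw [hread j hj y, norm_smul]
    have h1 : ‖∑ μ : Fin d, ((χf j y - χf j (unshift μ y) : ℝ) : 𝕜) • S (unshift μ y, μ) (a (unshift μ y, μ))‖ ≤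
        MT * ∑ μ : Fin d, |χf j y - χf j (unshift μ y)| * ‖a (unshift μ y, μ)‖ := by
      rw [mul_sum]
      refine (norm_sum_le _ _).trans (sum_le_sum fun μ _ => ?_)
      rw [norm_smul, RCLike.norm_ofReal]
      calc |χf j y - χf j (unshift μ y)| * ‖S (unshift μ y, μ) (a (unshift μ y, μ))‖
          ≤ |χf j y - χf j (unshift μ y)| * (MT * ‖a (unshift μ y, μ)‖) := mul_le_mul_of_nonneg_left (hR _ _) (abs_nonneg _)
        _ = MT * (|χf j y - χf j (unshift μ y)| * ‖a (unshift μ y, μ)‖) := by ring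
    have h2 : (∑ μ : Fin d, |χf j y - χf j (unshift μ y)| * ‖a (unshift μ y, μ)‖) ^ 2 ≤
        d * ∑ μ : Fin d, (χf j y - χf j (unshift μ y)) ^ 2 * ‖a (unshift μ y, μ)‖ ^ 2 := by
      have h := sq_sum_le_card_mul_sum_sq (s := (univ : Finset (Fin d))) (f := fun μ => |χf j y - χf j (unshift μ y)| * ‖a (unshift μ y, μ)‖)
      simp only [card_univ, Fintype.card_fin, mul_pow, sq_abs] at h
      simpa using h
    have hMT : 0 ≤ MT * ∑ μ : Fin d, |χf j y - χf j (unshift μ y)| * ‖a (unshift μ y, μ)‖ := (norm_nonneg _).trans h1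
    calc (‖c‖ * ‖∑ μ : Fin d, ((χf j y - χf j (unshift μ y) : ℝ) : 𝕜) • S (unshift μ y, μ) (a (unshift μ y, μ))‖) ^ 2
        ≤ (‖c‖ * (MT * ∑ μ : Fin d, |χf j y - χf j (unshift μ y)| * ‖a (unshift μ y, μ)‖)) ^ 2 := by gcongr
      _ = (‖c‖ * MT) ^ 2 * (∑ μ : Fin d, |χf j y - χf j (unshift μ y)| * ‖a (unshift μ y, μ)‖) ^ 2 := by ring
      _ ≤ (‖c‖ * MT) ^ 2 * (d * ∑ μ : Fin d, (χf j y - χf j (unshift μ y)) ^ 2 * ‖a (unshift μ y, μ)‖ ^ 2) :=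
          mul_le_mul_of_nonneg_left h2 (sq_nonneg _)
  -- the overlap bound on the incoming bonds
  have hov : ∀ (y : TSite d Pd) (μ : Fin d), ∑ j ∈ s, (χf j y - χf j (unshift μ y)) ^ 2 ≤ Θ₂ := fun y μ => by
    have h := hχ (unshift μ y, μ)
    simp only [bpos, btgt, shift_unshift] at h
    calc ∑ j ∈ s, (χf j y - χf j (unshift μ y)) ^ 2 = ∑ j ∈ s, (χf j (unshift μ y) - χf j y) ^ 2 :=
          sum_congr rfl fun j _ => by ring
      _ ≤ Θ₂ := h
  -- assemble: Σ_j ‖G_j‖² = Σ_j Σ_y c₀‖G_j y‖² ≤ …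
  have hsq : ∀ j ∈ s, ‖χ0f j (covDivL2K 𝕜 c₀ c S A) - covDivL2K 𝕜 c₀ c S (χSf j A)‖ ^ 2 =
      ∑ y : TSite d Pd, c₀ * ‖WL2.equiv 𝕜 _ W (χ0f j (covDivL2K 𝕜 c₀ c S A) - covDivL2K 𝕜 c₀ c S (χSf j A)) y‖ ^ 2 := fun j _ => WL2.norm_sq _
  rw [sum_congr rfl hsq, sum_comm]
  have hstep : ∀ y : TSite d Pd, ∑ j ∈ s, c₀ * ‖WL2.equiv 𝕜 _ W (χ0f j (covDivL2K 𝕜 c₀ c S A) - covDivL2K 𝕜 c₀ c S (χSf j A)) y‖ ^ 2 ≤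
      (‖c‖ * MT) ^ 2 * d * Θ₂ * ∑ μ : Fin d, c₀ * ‖a (unshift μ y, μ)‖ ^ 2 := fun y => by
    calc ∑ j ∈ s, c₀ * ‖WL2.equiv 𝕜 _ W (χ0f j (covDivL2K 𝕜 c₀ c S A) - covDivL2K 𝕜 c₀ c S (χSf j A)) y‖ ^ 2
        ≤ ∑ j ∈ s, c₀ * ((‖c‖ * MT) ^ 2 * (d * ∑ μ : Fin d, (χf j y - χf j (unshift μ y)) ^ 2 * ‖a (unshift μ y, μ)‖ ^ 2)) :=
          sum_le_sum fun j hj => mul_le_mul_of_nonneg_left (hpt j hj y) hc₀.le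
      _ = c₀ * (‖c‖ * MT) ^ 2 * d * ∑ μ : Fin d, (∑ j ∈ s, (χf j y - χf j (unshift μ y)) ^ 2) * ‖a (unshift μ y, μ)‖ ^ 2 := by
          rw [← mul_sum, ← mul_sum, ← mul_sum, sum_comm]
          simp only [← sum_mul]
          ring
      _ ≤ c₀ * (‖c‖ * MT) ^ 2 * d * ∑ μ : Fin d, Θ₂ * ‖a (unshift μ y, μ)‖ ^ 2 := by
          refine mul_le_mul_of_nonneg_left (sum_le_sum fun μ _ => ?_) (by positivity)
          exact mul_le_mul_of_nonneg_right (hov y μ) (sq_nonneg _)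
      _ = (‖c‖ * MT) ^ 2 * d * Θ₂ * ∑ μ : Fin d, c₀ * ‖a (unshift μ y, μ)‖ ^ 2 := by rw [mul_sum, mul_sum]; exact sum_congr rfl fun μ _ => by ring
  calc ∑ y : TSite d Pd, ∑ j ∈ s, c₀ * ‖WL2.equiv 𝕜 _ W (χ0f j (covDivL2K 𝕜 c₀ c S A) - covDivL2K 𝕜 c₀ c S (χSf j A)) y‖ ^ 2
      ≤ ∑ y : TSite d Pd, (‖c‖ * MT) ^ 2 * d * Θ₂ * ∑ μ : Fin d, c₀ * ‖a (unshift μ y, μ)‖ ^ 2 := sum_le_sum fun y _ => hstep y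
    _ = (‖c‖ * MT) ^ 2 * d * Θ₂ * ∑ b : Bond d Pd, c₀ * ‖a b‖ ^ 2 := by rw [← mul_sum, sum_site_dir_unshift (fun b => c₀ * ‖a b‖ ^ 2)]
    _ = d * (‖c‖ * MT) ^ 2 * Θ₂ * ‖A‖ ^ 2 := by rw [WL2.norm_sq A]; ring

/-- **THE DOUBLE-COMMUTATOR LETTER `k₂` ON `L²`** (row L7 for `T₂ = D*`): with `Σ_j(χ_j(b₋) − χ_j(b₊))² ≤ Θ₂` (`0 ≤ Θ₂`),
`‖Σ_j (χ0_j(χ0_j(D*A) − D*(χS_j A)) − (χ0_j(D*(χS_j A)) − D*(χS_j(χS_j A))))‖ ≤ √d·‖c‖M_TΘ₂·‖A‖`. [folklore]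
[cite: Balaban1985BackgroundPropagators, (3.100) p.413, p.414 «O(M⁻²)», (3.8) p.392] -/
theorem norm_sum_comm_comm_covDivL2K_le (hMT : 0 ≤ MT) (hR : ∀ b v, ‖S b v‖ ≤ MT * ‖v‖) {J : Type*} (s : Finset J)
    {χf : J → TSite d Pd → ℝ} {Θ₂ : ℝ} (hΘ : 0 ≤ Θ₂) (hχ : ∀ b : Bond d Pd, ∑ j ∈ s, (χf j (bpos b) - χf j (btgt b)) ^ 2 ≤ Θ₂)
    (χSf : J → BondL2K 𝕜 d Pd c₀ W → BondL2K 𝕜 d Pd c₀ W) (χ0f : J → SiteL2K 𝕜 d Pd c₀ W → SiteL2K 𝕜 d Pd c₀ W)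
    (hS : ∀ j (A : BondL2K 𝕜 d Pd c₀ W) (b : Bond d Pd), WL2.equiv 𝕜 _ W (χSf j A) b = (χf j (bpos b) : 𝕜) • WL2.equiv 𝕜 _ W A b)
    (h0 : ∀ j (f : SiteL2K 𝕜 d Pd c₀ W) (y : TSite d Pd), WL2.equiv 𝕜 _ W (χ0f j f) y = (χf j y : 𝕜) • WL2.equiv 𝕜 _ W f y) (c : 𝕜)
    (A : BondL2K 𝕜 d Pd c₀ W) :
    ‖∑ j ∈ s, (χ0f j (χ0f j (covDivL2K 𝕜 c₀ c S A) - covDivL2K 𝕜 c₀ c S (χSf j A)) -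
        (χ0f j (covDivL2K 𝕜 c₀ c S (χSf j A)) - covDivL2K 𝕜 c₀ c S (χSf j (χSf j A))))‖ ≤ Real.sqrt d * (‖c‖ * Θ₂ * MT) * ‖A‖ := by
  refine norm_site_le_of_instar_bound A _ (by positivity) fun y => ?_
  have hSA : ∀ j (B : BondL2K 𝕜 d Pd c₀ W), WL2.equiv 𝕜 _ W (χSf j B) = fun b => (χf j (bpos b) : 𝕜) • WL2.equiv 𝕜 _ W B b :=
    fun j B => funext (hS j B)
  have hread : WL2.equiv 𝕜 _ W (∑ j ∈ s, (χ0f j (χ0f j (covDivL2K 𝕜 c₀ c S A) - covDivL2K 𝕜 c₀ c S (χSf j A)) -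
      (χ0f j (covDivL2K 𝕜 c₀ c S (χSf j A)) - covDivL2K 𝕜 c₀ c S (χSf j (χSf j A))))) y =
      ∑ j ∈ s, ((χf j y : 𝕜) • ((χf j y : 𝕜) • covDiv c S (WL2.equiv 𝕜 _ W A) y -
          covDiv c S (fun b => (χf j (bpos b) : 𝕜) • WL2.equiv 𝕜 _ W A b) y) -
        ((χf j y : 𝕜) • covDiv c S (fun b => (χf j (bpos b) : 𝕜) • WL2.equiv 𝕜 _ W A b) y -
          covDiv c S (fun b => (χf j (bpos b) : 𝕜) • ((χf j (bpos b) : 𝕜) • WL2.equiv 𝕜 _ W A b)) y)) := by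
    rw [equiv_sum]
    refine sum_congr rfl fun j _ => ?_
    have h2 : WL2.equiv 𝕜 _ W (χSf j (χSf j A)) = fun b => (χf j (bpos b) : 𝕜) • ((χf j (bpos b) : 𝕜) • WL2.equiv 𝕜 _ W A b) := by
      rw [hSA j (χSf j A)]; exact funext fun b => by rw [hSA j A]
    rw [WL2.equiv_sub, Pi.sub_apply, h0, WL2.equiv_sub, Pi.sub_apply, h0, WL2.equiv_sub, Pi.sub_apply, h0]
    simp only [equiv_covDivL2K]
    rw [h2, hSA j A]
  rw [hread, sum_comm_comm_covDiv_apply s (fun j x => (χf j x : 𝕜)) c S _ y]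
  simp only [← RCLike.ofReal_sub, ← RCLike.ofReal_pow, ← RCLike.ofReal_sum]
  refine norm_smul_sum_le hR c (fun μ => ?_) _ y
  have h := hχ (unshift μ y, μ)
  simp only [bpos, btgt, shift_unshift] at h
  rw [abs_of_nonneg (sum_nonneg fun j _ => sq_nonneg _)]
  calc ∑ j ∈ s, (χf j y - χf j (unshift μ y)) ^ 2 = ∑ j ∈ s, (χf j (unshift μ y) - χf j y) ^ 2 := sum_congr rfl fun j _ => by ring
    _ ≤ Θ₂ := h

omit [Fact (0 < c₀)] in
/-- pointwise size of `D*` itself: `‖(D*A)(y)‖ ≤ ‖c‖(1+M_T)·Σ_μ (‖A(y−e_μ,μ)‖ + ‖A(y,μ)‖)`. [folklore] [cite: Balaban1985BackgroundPropagators, (3.8) p.392] -/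
private theorem norm_covDiv_apply_le (hMT : 0 ≤ MT) (hR : ∀ b v, ‖S b v‖ ≤ MT * ‖v‖) (c : 𝕜) (a : Bond d Pd → W) (y : TSite d Pd) :
    ‖covDiv c S a y‖ ≤ ‖c‖ * (1 + MT) * ∑ μ : Fin d, (‖a (unshift μ y, μ)‖ + ‖a (y, μ)‖) := by
  rw [covDiv_apply, norm_smul, mul_assoc, mul_sum]
  refine mul_le_mul_of_nonneg_left ((norm_sum_le _ _).trans (sum_le_sum fun μ _ => ?_)) (norm_nonneg c)
  calc ‖S (unshift μ y, μ) (a (unshift μ y, μ)) - a (y, μ)‖ ≤ MT * ‖a (unshift μ y, μ)‖ + ‖a (y, μ)‖ :=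
        (norm_sub_le _ _).trans (add_le_add (hR _ _) le_rfl)
    _ ≤ (1 + MT) * (‖a (unshift μ y, μ)‖ + ‖a (y, μ)‖) := by
        nlinarith [norm_nonneg (a (unshift μ y, μ)), norm_nonneg (a (y, μ))]

/-- **THE `t₂` LETTER IN THE `M_T` CURRENCY**: `‖D*A‖ ≤ 2√d·‖c‖(1+M_T)·‖A‖` — directly from (3.8), any `S`, any `c` (the tree's
`B9Eq373DerivativeRemainderL2.norm_covDivL2K_le` reaches `2(1+εR)‖c‖√d` through the adjoint road, needing `conj c = c` and adjoint data). [folklore]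
[cite: Balaban1985BackgroundPropagators, (3.8) p.392, (3.11) p.392] -/
theorem norm_covDivL2K_le_of_transport (hMT : 0 ≤ MT) (hR : ∀ b v, ‖S b v‖ ≤ MT * ‖v‖) (c : 𝕜) (A : BondL2K 𝕜 d Pd c₀ W) :
    ‖covDivL2K 𝕜 c₀ c S A‖ ≤ 2 * Real.sqrt d * (‖c‖ * (1 + MT)) * ‖A‖ :=
  norm_site_le_of_star_bound A _ (by positivity) fun y => by
    rw [equiv_covDivL2K]
    exact norm_covDiv_apply_le hMT hR c _ y

end L2

/-! ## §4 Non-vacuity: a constant cutoff commutes with the divergence -/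

section Sanity

/-- With a CONSTANT cutoff both sides of `comm_covDiv_apply` vanish (the hypotheses of §3 hold with `θ = 0`, `Θ₂ = 0`). [folklore] -/
example {d : ℕ} {Pd : Fin d → ℕ} (c r : ℂ) (S : Bond d Pd → ℂ →ₗ[ℂ] ℂ) (A : Bond d Pd → ℂ) (y : TSite d Pd) :
    r • covDiv c S A y - covDiv c S (fun b => r • A b) y = 0 := by
  rw [comm_covDiv_apply (fun _ => r) c S A y]
  simp

end Sanity

end Literature.MathematicalPhysics.QuantumFieldTheory.Balaban1983to89.B9Eq3100LeibnizCommutatorDiv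

end
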